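import Summits.Ventures.CertifiedArithmetic.Expansions.Orient3dStageC
import Summits.Ventures.CertifiedArithmetic.Expansions.EstimateRelativeError
import Summits.Ventures.CertifiedArithmetic.Expansions.StageBMarginsAttained
import Literature.ComputerArithmetic.GraillatLefevreMuller2015.IntegerPowers
import Mathlib.Tactic.NormNum
import Mathlib.Tactic.Linarith
import Mathlib.Tactic.Positivity
import Mathlib.Tactic.Ring

/-!
# Stage C of ORIENT3D is sound — the unconditional statements

NEW WORK in the sense of this development (a corollary file; nothing here is a literature fact).
`Orient3dStageC.lean` proves the soundness of the stage-C test of `orient3dadapt` generically in the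
relative error bound `δ` of `estimate` on W-expansions of floats and in the coefficient `K_R`, and
instantiates the lane's `δ = 3ε`, `K_R = (3 + 24ε)ε` (`orient3dStageC_correct_of_estimate`).
`EstimateRelativeError.lean` proves `δ = 3ε` (`abs_estimate_sub_sum_le_of_isWeakExpansion`) and the
sharp `δ = (5/2)ε` (`abs_estimate_sub_sum_le_sharp_of_isWeakExpansion`); `StageBMarginsAttained`
proves the margin of Shewchuk's PRINTED `K_R = (3 + 8ε)ε` for `δ = (5/2)ε`, `p ≥ 5`.  This file
discharges the hypotheses: the FMA / Dekker two-product instances given the estimate bound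
(`orient3dStageC_fma_correct_of_estimate`, `orient3dStageC_dekker_correct_of_estimate`), the
unconditional statements with the lane's `K_R = (3 + 24ε)ε` (`p ≥ 4`), and the unconditional
statements with the PRINTED `K_R = (3 + 8ε)ε` (`p ≥ 5`: `orient3dStageC_correct_printed`,
`orient3dStageC_fma_correct_printed`).

* `orient3dStageC_correct` — `p ≥ 4`, `fl` a `RoundoffBelow 2` round-to-nearest into `F(p, emin)`,
  coordinates in `F(p, e₀)` with `emin ≤ e₀`, `emin + 3p ≤ 3e₀`, `tp` error-free on `F(p, e₀)²` and
  `F(p, 2e₀) × F(p, e₀)`: if stage C (coefficients `o3derrboundC p`, `o3dresulterrbound24 p`, stage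
  A's permanent) returns `d`, then `d > 0 ↔ (7) > 0` and `d < 0 ↔ (7) < 0` for the exact
  `orient3dDet`.
* `orient3dStageC_fma_correct`, `orient3dStageC_dekker_correct` — the FMA two-product; Dekker's
  TWO-PRODUCT with `predicates.c`'s splitter (`p ≤ 2s ≤ p + 1`, rounding odd,
  `e₀ ≥ emin + p − 1`, `2e₀ ≥ emin + 2p − 1`).
* `orient3dStageB_estimate_sign_of_tails_zero` — the early exit "all tails zero ⇒ return stage
  B's `det`" returns a value with the sign of `(7)`, zero included.

HONEST CAVEATS, unchanged: exact model over `ℚ`, no overflow; for binary64 the format hypothesis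
means coordinates that are multiples of `2^−305`; `K_R = (3 + 24ε)ε` is ours; `predicates.c`'s
`(3 + 8ε)ε` is certified here for `p ≥ 5`; only the SIGN of the
returned value is claimed; stage D is not treated here.

References: J. R. Shewchuk, Discrete Comput. Geom. 18 (1997) 305–363, §4.3–4.4 and `predicates.c`
[Shewchuk1997].
-/

namespace Summit.Ventures.CertifiedArithmetic.Expansions

open Literature.ComputerArithmetic.JeannerodRump2018
open Literature.ComputerArithmetic.BoldoJeannerodMelquiondMuller2023 hiding twoSum twoSum_fst
  isFloat_twoSum
open Literature.ComputerArithmetic.Shewchuk1997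

variable {p : ℕ} {emin : ℤ} {fl : ℚ → ℚ}

/-! ## Instances given the `estimate` bound: FMA two-product; Dekker two-product -/

/-- **Stage C with the FMA two-product** (`2Prod_FMA`), given the `estimate` bound: sound for
`p ≥ 4`, any `RoundoffBelow 2` round-to-nearest, coordinates in `F(p, e₀)` with `emin ≤ e₀`,
`emin + 3p ≤ 3e₀`. -/
theorem orient3dStageC_fma_correct_of_estimate (hp : 4 ≤ p) (hfl : IsRoundNearest p emin fl)
    (hfl2 : RoundoffBelow 2 fl)
    (hest3 : ∀ ⦃l : List ℚ⦄, (∀ x ∈ l, IsFloat p emin x) → IsWeakExpansion l →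
      |estimate fl l - l.sum| ≤ 3 * unitRoundoff p * |l.sum|)
    {e₀ : ℤ} (he₀ : emin ≤ e₀) (h3p : emin + 3 * p ≤ e₀ + e₀ + e₀)
    {a₁ a₂ a₃ b₁ b₂ b₃ c₁ c₂ c₃ d₁ d₂ d₃ : ℚ}
    (ha₁ : IsFloat p e₀ a₁) (ha₂ : IsFloat p e₀ a₂) (ha₃ : IsFloat p e₀ a₃)
    (hb₁ : IsFloat p e₀ b₁) (hb₂ : IsFloat p e₀ b₂) (hb₃ : IsFloat p e₀ b₃)
    (hc₁ : IsFloat p e₀ c₁) (hc₂ : IsFloat p e₀ c₂) (hc₃ : IsFloat p e₀ c₃)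
    (hd₁ : IsFloat p e₀ d₁) (hd₂ : IsFloat p e₀ d₂) (hd₃ : IsFloat p e₀ d₃) {d : ℚ}
    (hC : orient3dStageC (twoProdFMA fl) fl (o3derrboundC p) (o3dresulterrbound24 p)
      (orient3dPermanent fl a₁ a₂ a₃ b₁ b₂ b₃ c₁ c₂ c₃ d₁ d₂ d₃)
      a₁ a₂ a₃ b₁ b₂ b₃ c₁ c₂ c₃ d₁ d₂ d₃ = some d) :
    (0 < d ↔ 0 < orient3dDet a₁ a₂ a₃ b₁ b₂ b₃ c₁ c₂ c₃ d₁ d₂ d₃) ∧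
      (d < 0 ↔ orient3dDet a₁ a₂ a₃ b₁ b₂ b₃ c₁ c₂ c₃ d₁ d₂ d₃ < 0) := by
  have hp1 : 1 ≤ p := le_trans (by norm_num) hp
  have he₂ : emin ≤ e₀ + e₀ := by omega
  have he₃ : emin ≤ e₀ + e₀ + e₀ := by omega
  exact orient3dStageC_correct_of_estimate hp hfl hfl2 hest3 he₀ h3p ha₁ ha₂ ha₃ hb₁ hb₂ hb₃ hc₁
    hc₂ hc₃ hd₁ hd₂ hd₃ (fun x y hx hy => exactTwoProd_twoProdFMA₂ hp1 hfl he₂ hx hy)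
    (fun x y hx hy => exactTwoProd_twoProdFMA₂ hp1 hfl he₃ hx hy) hC

/-- **Stage C with Shewchuk's TWO-PRODUCT** (Dekker, split point `s`, `p ≤ 2s ≤ p + 1`, rounding
odd and `RoundoffBelow 2` — ties-to-even qualifies), given the `estimate` bound: sound for `p ≥ 4`
and coordinates in `F(p, e₀)` with `e₀ ≥ emin + p − 1`, `2e₀ ≥ emin + 2p − 1`, `3e₀ ≥ emin + 3p`
(Theorem 18's no-underflow regime for the two-products, plus stage C's grids). -/
theorem orient3dStageC_dekker_correct_of_estimate (hp : 4 ≤ p) {s : ℕ} (hs2 : p ≤ 2 * s)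
    (hs2' : 2 * s ≤ p + 1) (hfl : IsRoundNearest p emin fl) (hodd : ∀ t, fl (-t) = -fl t)
    (hfl2 : RoundoffBelow 2 fl)
    (hest3 : ∀ ⦃l : List ℚ⦄, (∀ x ∈ l, IsFloat p emin x) → IsWeakExpansion l →
      |estimate fl l - l.sum| ≤ 3 * unitRoundoff p * |l.sum|)
    {e₀ : ℤ} (h1 : emin + p - 1 ≤ e₀)
    (h2 : emin + 2 * p - 1 ≤ e₀ + e₀) (h3p : emin + 3 * p ≤ e₀ + e₀ + e₀)
    {a₁ a₂ a₃ b₁ b₂ b₃ c₁ c₂ c₃ d₁ d₂ d₃ : ℚ}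
    (ha₁ : IsFloat p e₀ a₁) (ha₂ : IsFloat p e₀ a₂) (ha₃ : IsFloat p e₀ a₃)
    (hb₁ : IsFloat p e₀ b₁) (hb₂ : IsFloat p e₀ b₂) (hb₃ : IsFloat p e₀ b₃)
    (hc₁ : IsFloat p e₀ c₁) (hc₂ : IsFloat p e₀ c₂) (hc₃ : IsFloat p e₀ c₃)
    (hd₁ : IsFloat p e₀ d₁) (hd₂ : IsFloat p e₀ d₂) (hd₃ : IsFloat p e₀ d₃) {d : ℚ}
    (hC : orient3dStageC (twoProduct fl s) fl (o3derrboundC p) (o3dresulterrbound24 p)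
      (orient3dPermanent fl a₁ a₂ a₃ b₁ b₂ b₃ c₁ c₂ c₃ d₁ d₂ d₃)
      a₁ a₂ a₃ b₁ b₂ b₃ c₁ c₂ c₃ d₁ d₂ d₃ = some d) :
    (0 < d ↔ 0 < orient3dDet a₁ a₂ a₃ b₁ b₂ b₃ c₁ c₂ c₃ d₁ d₂ d₃) ∧
      (d < 0 ↔ orient3dDet a₁ a₂ a₃ b₁ b₂ b₃ c₁ c₂ c₃ d₁ d₂ d₃ < 0) := by
  have he₀ : emin ≤ e₀ := by omega
  exact orient3dStageC_correct_of_estimate hp hfl hfl2 hest3 he₀ h3p ha₁ ha₂ ha₃ hb₁ hb₂ hb₃ hc₁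
    hc₂ hc₃ hd₁ hd₂ hd₃
    (fun x y hx hy => exactTwoProd_twoProduct₂ hp hs2 hs2' hfl hodd h1 h1 h2 hx hy)
    (fun x y hx hy => exactTwoProd_twoProduct₂ hp hs2 hs2' hfl hodd (by omega) h1 (by omega) hx hy)
    hC

/-! ## The unconditional statements (the lane's `K_R = (3 + 24ε)ε`) -/

/-- **THE STAGE-C TEST OF `orient3dadapt` IS SOUND with `K_C = (26 + 288ε)ε²`, `K_R = (3 + 24ε)ε`**
(`p ≥ 4`, any `RoundoffBelow 2` round-to-nearest, coordinates in `F(p, e₀)` with `emin ≤ e₀`,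
`emin + 3p ≤ 3e₀`, two-product error-free on `F(p, e₀)²` and `F(p, 2e₀) × F(p, e₀)`): if stage C
returns `d`, then `d > 0 ↔ (7) > 0` and `d < 0 ↔ (7) < 0`. -/
theorem orient3dStageC_correct (hp : 4 ≤ p) (hfl : IsRoundNearest p emin fl)
    (hfl2 : RoundoffBelow 2 fl) {e₀ : ℤ} (he₀ : emin ≤ e₀) (h3p : emin + 3 * p ≤ e₀ + e₀ + e₀)
    {a₁ a₂ a₃ b₁ b₂ b₃ c₁ c₂ c₃ d₁ d₂ d₃ : ℚ}
    (ha₁ : IsFloat p e₀ a₁) (ha₂ : IsFloat p e₀ a₂) (ha₃ : IsFloat p e₀ a₃)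
    (hb₁ : IsFloat p e₀ b₁) (hb₂ : IsFloat p e₀ b₂) (hb₃ : IsFloat p e₀ b₃)
    (hc₁ : IsFloat p e₀ c₁) (hc₂ : IsFloat p e₀ c₂) (hc₃ : IsFloat p e₀ c₃)
    (hd₁ : IsFloat p e₀ d₁) (hd₂ : IsFloat p e₀ d₂) (hd₃ : IsFloat p e₀ d₃)
    {tp : ℚ → ℚ → ℚ × ℚ}
    (htp : ∀ x y, IsFloat p e₀ x → IsFloat p e₀ y → ExactTwoProd p emin fl tp x y)
    (htp' : ∀ x y, IsFloat p (e₀ + e₀) x → IsFloat p e₀ y → ExactTwoProd p emin fl tp x y)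
    {d : ℚ}
    (hC : orient3dStageC tp fl (o3derrboundC p) (o3dresulterrbound24 p)
      (orient3dPermanent fl a₁ a₂ a₃ b₁ b₂ b₃ c₁ c₂ c₃ d₁ d₂ d₃)
      a₁ a₂ a₃ b₁ b₂ b₃ c₁ c₂ c₃ d₁ d₂ d₃ = some d) :
    (0 < d ↔ 0 < orient3dDet a₁ a₂ a₃ b₁ b₂ b₃ c₁ c₂ c₃ d₁ d₂ d₃) ∧
      (d < 0 ↔ orient3dDet a₁ a₂ a₃ b₁ b₂ b₃ c₁ c₂ c₃ d₁ d₂ d₃ < 0) :=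
  orient3dStageC_correct_of_estimate hp hfl hfl2
    (fun _ hF hW =>
      abs_estimate_sub_sum_le_of_isWeakExpansion (le_trans (by norm_num) hp) hfl hF hW)
    he₀ h3p ha₁ ha₂ ha₃ hb₁ hb₂ hb₃ hc₁ hc₂ hc₃ hd₁ hd₂ hd₃ htp htp' hC

/-- **Stage C with the FMA two-product** is sound (`p ≥ 4`, any `RoundoffBelow 2`
round-to-nearest, coordinates in `F(p, e₀)` with `emin ≤ e₀`, `emin + 3p ≤ 3e₀`). -/
theorem orient3dStageC_fma_correct (hp : 4 ≤ p) (hfl : IsRoundNearest p emin fl)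
    (hfl2 : RoundoffBelow 2 fl) {e₀ : ℤ} (he₀ : emin ≤ e₀) (h3p : emin + 3 * p ≤ e₀ + e₀ + e₀)
    {a₁ a₂ a₃ b₁ b₂ b₃ c₁ c₂ c₃ d₁ d₂ d₃ : ℚ}
    (ha₁ : IsFloat p e₀ a₁) (ha₂ : IsFloat p e₀ a₂) (ha₃ : IsFloat p e₀ a₃)
    (hb₁ : IsFloat p e₀ b₁) (hb₂ : IsFloat p e₀ b₂) (hb₃ : IsFloat p e₀ b₃)
    (hc₁ : IsFloat p e₀ c₁) (hc₂ : IsFloat p e₀ c₂) (hc₃ : IsFloat p e₀ c₃)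
    (hd₁ : IsFloat p e₀ d₁) (hd₂ : IsFloat p e₀ d₂) (hd₃ : IsFloat p e₀ d₃) {d : ℚ}
    (hC : orient3dStageC (twoProdFMA fl) fl (o3derrboundC p) (o3dresulterrbound24 p)
      (orient3dPermanent fl a₁ a₂ a₃ b₁ b₂ b₃ c₁ c₂ c₃ d₁ d₂ d₃)
      a₁ a₂ a₃ b₁ b₂ b₃ c₁ c₂ c₃ d₁ d₂ d₃ = some d) :
    (0 < d ↔ 0 < orient3dDet a₁ a₂ a₃ b₁ b₂ b₃ c₁ c₂ c₃ d₁ d₂ d₃) ∧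
      (d < 0 ↔ orient3dDet a₁ a₂ a₃ b₁ b₂ b₃ c₁ c₂ c₃ d₁ d₂ d₃ < 0) :=
  orient3dStageC_fma_correct_of_estimate hp hfl hfl2
    (fun _ hF hW =>
      abs_estimate_sub_sum_le_of_isWeakExpansion (le_trans (by norm_num) hp) hfl hF hW)
    he₀ h3p ha₁ ha₂ ha₃ hb₁ hb₂ hb₃ hc₁ hc₂ hc₃ hd₁ hd₂ hd₃ hC

/-- **Stage C with Shewchuk's TWO-PRODUCT** (Dekker, split point `s`, `p ≤ 2s ≤ p + 1`, rounding
odd and `RoundoffBelow 2`) is sound for `p ≥ 4` and coordinates in `F(p, e₀)` with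
`e₀ ≥ emin + p − 1`, `2e₀ ≥ emin + 2p − 1`, `3e₀ ≥ emin + 3p`. -/
theorem orient3dStageC_dekker_correct (hp : 4 ≤ p) {s : ℕ} (hs2 : p ≤ 2 * s)
    (hs2' : 2 * s ≤ p + 1) (hfl : IsRoundNearest p emin fl) (hodd : ∀ t, fl (-t) = -fl t)
    (hfl2 : RoundoffBelow 2 fl) {e₀ : ℤ} (h1 : emin + p - 1 ≤ e₀)
    (h2 : emin + 2 * p - 1 ≤ e₀ + e₀) (h3p : emin + 3 * p ≤ e₀ + e₀ + e₀)
    {a₁ a₂ a₃ b₁ b₂ b₃ c₁ c₂ c₃ d₁ d₂ d₃ : ℚ}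
    (ha₁ : IsFloat p e₀ a₁) (ha₂ : IsFloat p e₀ a₂) (ha₃ : IsFloat p e₀ a₃)
    (hb₁ : IsFloat p e₀ b₁) (hb₂ : IsFloat p e₀ b₂) (hb₃ : IsFloat p e₀ b₃)
    (hc₁ : IsFloat p e₀ c₁) (hc₂ : IsFloat p e₀ c₂) (hc₃ : IsFloat p e₀ c₃)
    (hd₁ : IsFloat p e₀ d₁) (hd₂ : IsFloat p e₀ d₂) (hd₃ : IsFloat p e₀ d₃) {d : ℚ}
    (hC : orient3dStageC (twoProduct fl s) fl (o3derrboundC p) (o3dresulterrbound24 p)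
      (orient3dPermanent fl a₁ a₂ a₃ b₁ b₂ b₃ c₁ c₂ c₃ d₁ d₂ d₃)
      a₁ a₂ a₃ b₁ b₂ b₃ c₁ c₂ c₃ d₁ d₂ d₃ = some d) :
    (0 < d ↔ 0 < orient3dDet a₁ a₂ a₃ b₁ b₂ b₃ c₁ c₂ c₃ d₁ d₂ d₃) ∧
      (d < 0 ↔ orient3dDet a₁ a₂ a₃ b₁ b₂ b₃ c₁ c₂ c₃ d₁ d₂ d₃ < 0) :=
  orient3dStageC_dekker_correct_of_estimate hp hs2 hs2' hfl hodd hfl2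
    (fun _ hF hW =>
      abs_estimate_sub_sum_le_of_isWeakExpansion (le_trans (by norm_num) hp) hfl hF hW)
    h1 h2 h3p ha₁ ha₂ ha₃ hb₁ hb₂ hb₃ hc₁ hc₂ hc₃ hd₁ hd₂ hd₃ hC

/-- **The early exit is sound**: if all nine TWO-DIFF-TAILs vanish, stage B's
`det = estimate(fin1)` has the sign of the exact determinant, zero included (`p ≥ 4`, any
`RoundoffBelow 2` round-to-nearest, `emin ≤ e₀`, `emin ≤ 2e₀`, `emin ≤ 3e₀`). -/
theorem orient3dStageB_estimate_sign_of_tails_zero (hp : 4 ≤ p) (hfl : IsRoundNearest p emin fl)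
    (hfl2 : RoundoffBelow 2 fl) {e₀ : ℤ} (he₀ : emin ≤ e₀) (he₂ : emin ≤ e₀ + e₀)
    (he₃ : emin ≤ e₀ + e₀ + e₀) {a₁ a₂ a₃ b₁ b₂ b₃ c₁ c₂ c₃ d₁ d₂ d₃ : ℚ}
    (ha₁ : IsFloat p e₀ a₁) (ha₂ : IsFloat p e₀ a₂) (ha₃ : IsFloat p e₀ a₃)
    (hb₁ : IsFloat p e₀ b₁) (hb₂ : IsFloat p e₀ b₂) (hb₃ : IsFloat p e₀ b₃)
    (hc₁ : IsFloat p e₀ c₁) (hc₂ : IsFloat p e₀ c₂) (hc₃ : IsFloat p e₀ c₃)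
    (hd₁ : IsFloat p e₀ d₁) (hd₂ : IsFloat p e₀ d₂) (hd₃ : IsFloat p e₀ d₃)
    {tp : ℚ → ℚ → ℚ × ℚ}
    (htp : ∀ x y, IsFloat p e₀ x → IsFloat p e₀ y → ExactTwoProd p emin fl tp x y)
    (htp' : ∀ x y, IsFloat p (e₀ + e₀) x → IsFloat p e₀ y → ExactTwoProd p emin fl tp x y)
    (hta₁ : fl (a₁ - d₁) = a₁ - d₁) (hta₂ : fl (a₂ - d₂) = a₂ - d₂) (hta₃ : fl (a₃ - d₃) = a₃ - d₃)
    (htb₁ : fl (b₁ - d₁) = b₁ - d₁) (htb₂ : fl (b₂ - d₂) = b₂ - d₂) (htb₃ : fl (b₃ - d₃) = b₃ - d₃)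
    (htc₁ : fl (c₁ - d₁) = c₁ - d₁) (htc₂ : fl (c₂ - d₂) = c₂ - d₂)
    (htc₃ : fl (c₃ - d₃) = c₃ - d₃) :
    let det := estimate fl (orient3dB tp fl (fl (a₁ - d₁)) (fl (a₂ - d₂)) (fl (a₃ - d₃))
      (fl (b₁ - d₁)) (fl (b₂ - d₂)) (fl (b₃ - d₃)) (fl (c₁ - d₁)) (fl (c₂ - d₂)) (fl (c₃ - d₃)))
    (0 < det ↔ 0 < orient3dDet a₁ a₂ a₃ b₁ b₂ b₃ c₁ c₂ c₃ d₁ d₂ d₃) ∧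
      (det < 0 ↔ orient3dDet a₁ a₂ a₃ b₁ b₂ b₃ c₁ c₂ c₃ d₁ d₂ d₃ < 0) :=
  orient3dStageB_estimate_sign_of_tails hp hfl hfl2
    (fun _ hF hW =>
      abs_estimate_sub_sum_le_of_isWeakExpansion (le_trans (by norm_num) hp) hfl hF hW)
    he₀ he₂ he₃ ha₁ ha₂ ha₃ hb₁ hb₂ hb₃ hc₁ hc₂ hc₃ hd₁ hd₂ hd₃ htp htp' hta₁ hta₂ hta₃ htb₁ htb₂
    htb₃ htc₁ htc₂ htc₃

/-! ## Shewchuk's printed coefficients, `p ≥ 5` -/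

/-- **SHEWCHUK'S PRINTED STAGE-C LINE IS CERTIFIED for `p ≥ 5`** (binary32, binary64, …): stage C
of `orient3dadapt` run with the PRINTED coefficients `K_C = (26 + 288ε)ε²` and
`K_R = resulterrbound p = (3 + 8ε)ε` returns only values with the sign of the exact determinant
(same format / two-product hypotheses as `orient3dStageC_correct`).  Ingredients: the sharp `(5/2)ε`
relative error bound of `estimate` on W-expansions
(`EstimateRelativeError.abs_estimate_sub_sum_le_sharp_of_isWeakExpansion`) and the margin
`StageBMarginsAttained.resulterrbound_margin_of_le_five_halves` (it holds from `p = 5`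
on, `GraillatLefevreMuller2015.unitRoundoff_le_of_five_le`, and fails at `p = 4`).  Within the
model only: exact arithmetic over `ℚ`, no overflow, inputs on the stated grid; the sign, not the
value. -/
theorem orient3dStageC_correct_printed (hp : 5 ≤ p) (hfl : IsRoundNearest p emin fl)
    (hfl2 : RoundoffBelow 2 fl) {e₀ : ℤ} (he₀ : emin ≤ e₀) (h3p : emin + 3 * p ≤ e₀ + e₀ + e₀)
    {a₁ a₂ a₃ b₁ b₂ b₃ c₁ c₂ c₃ d₁ d₂ d₃ : ℚ}
    (ha₁ : IsFloat p e₀ a₁) (ha₂ : IsFloat p e₀ a₂) (ha₃ : IsFloat p e₀ a₃)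
    (hb₁ : IsFloat p e₀ b₁) (hb₂ : IsFloat p e₀ b₂) (hb₃ : IsFloat p e₀ b₃)
    (hc₁ : IsFloat p e₀ c₁) (hc₂ : IsFloat p e₀ c₂) (hc₃ : IsFloat p e₀ c₃)
    (hd₁ : IsFloat p e₀ d₁) (hd₂ : IsFloat p e₀ d₂) (hd₃ : IsFloat p e₀ d₃)
    {tp : ℚ → ℚ → ℚ × ℚ}
    (htp : ∀ x y, IsFloat p e₀ x → IsFloat p e₀ y → ExactTwoProd p emin fl tp x y)
    (htp' : ∀ x y, IsFloat p (e₀ + e₀) x → IsFloat p e₀ y → ExactTwoProd p emin fl tp x y)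
    {d : ℚ}
    (hC : orient3dStageC tp fl (o3derrboundC p) (resulterrbound p)
      (orient3dPermanent fl a₁ a₂ a₃ b₁ b₂ b₃ c₁ c₂ c₃ d₁ d₂ d₃)
      a₁ a₂ a₃ b₁ b₂ b₃ c₁ c₂ c₃ d₁ d₂ d₃ = some d) :
    (0 < d ↔ 0 < orient3dDet a₁ a₂ a₃ b₁ b₂ b₃ c₁ c₂ c₃ d₁ d₂ d₃) ∧
      (d < 0 ↔ orient3dDet a₁ a₂ a₃ b₁ b₂ b₃ c₁ c₂ c₃ d₁ d₂ d₃ < 0) := by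
  have hp2 : 2 ≤ p := le_trans (by norm_num) hp
  have hp4 : 4 ≤ p := le_trans (by norm_num) hp
  have hu0 : 0 < unitRoundoff p := by unfold unitRoundoff; positivity
  have hu16 : unitRoundoff p ≤ 1 / 16 :=
    Literature.ComputerArithmetic.BoldoMuller2011.unitRoundoff_le_sixteenth hp4
  have hm := resulterrbound_margin_of_le_five_halves hu0
    (Literature.ComputerArithmetic.GraillatLefevreMuller2015.unitRoundoff_le_of_five_le hp)
    (le_of_eq (by ring) : 5 / 2 * unitRoundoff p ≤ 5 * unitRoundoff p / 2)
  exact orient3dStageC_correct_of_estimate_of_margin hp4 hfl hfl2 (by positivity) (by linarith)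
    (onGrid_resulterrbound p) (lt_of_lt_of_eq hm (by unfold resulterrbound; ring))
    (fun _ hF hW => abs_estimate_sub_sum_le_sharp_of_isWeakExpansion hp2 hfl hF hW) he₀ h3p ha₁ ha₂
    ha₃ hb₁ hb₂ hb₃ hc₁ hc₂ hc₃ hd₁ hd₂ hd₃ htp htp' hC

/-- **The printed line with the FMA two-product**, `p ≥ 5` (e.g. binary64 with hardware FMA). -/
theorem orient3dStageC_fma_correct_printed (hp : 5 ≤ p) (hfl : IsRoundNearest p emin fl)
    (hfl2 : RoundoffBelow 2 fl) {e₀ : ℤ} (he₀ : emin ≤ e₀) (h3p : emin + 3 * p ≤ e₀ + e₀ + e₀)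
    {a₁ a₂ a₃ b₁ b₂ b₃ c₁ c₂ c₃ d₁ d₂ d₃ : ℚ}
    (ha₁ : IsFloat p e₀ a₁) (ha₂ : IsFloat p e₀ a₂) (ha₃ : IsFloat p e₀ a₃)
    (hb₁ : IsFloat p e₀ b₁) (hb₂ : IsFloat p e₀ b₂) (hb₃ : IsFloat p e₀ b₃)
    (hc₁ : IsFloat p e₀ c₁) (hc₂ : IsFloat p e₀ c₂) (hc₃ : IsFloat p e₀ c₃)
    (hd₁ : IsFloat p e₀ d₁) (hd₂ : IsFloat p e₀ d₂) (hd₃ : IsFloat p e₀ d₃) {d : ℚ}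
    (hC : orient3dStageC (twoProdFMA fl) fl (o3derrboundC p) (resulterrbound p)
      (orient3dPermanent fl a₁ a₂ a₃ b₁ b₂ b₃ c₁ c₂ c₃ d₁ d₂ d₃)
      a₁ a₂ a₃ b₁ b₂ b₃ c₁ c₂ c₃ d₁ d₂ d₃ = some d) :
    (0 < d ↔ 0 < orient3dDet a₁ a₂ a₃ b₁ b₂ b₃ c₁ c₂ c₃ d₁ d₂ d₃) ∧
      (d < 0 ↔ orient3dDet a₁ a₂ a₃ b₁ b₂ b₃ c₁ c₂ c₃ d₁ d₂ d₃ < 0) := by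
  have hp1 : 1 ≤ p := le_trans (by norm_num) hp
  have he₂ : emin ≤ e₀ + e₀ := by omega
  have he₃ : emin ≤ e₀ + e₀ + e₀ := by omega
  exact orient3dStageC_correct_printed hp hfl hfl2 he₀ h3p ha₁ ha₂ ha₃ hb₁ hb₂ hb₃ hc₁ hc₂ hc₃ hd₁
    hd₂ hd₃ (fun x y hx hy => exactTwoProd_twoProdFMA₂ hp1 hfl he₂ hx hy)
    (fun x y hx hy => exactTwoProd_twoProdFMA₂ hp1 hfl he₃ hx hy) hC

end Summit.Ventures.CertifiedArithmetic.Expansions
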